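import Summits.QuantumFields.YangMills.Theorems.CentreWallReflectionSlabActions
import HarnessLib

/-!
# Slab decomposition of the four-torus Wilson weight, II: edge sets, `DependsOn`, gluing, Fubini
# (crux `CentreWallReflection.WallReflection` ⟨stmt-QuantumFields-23707⟩, line `birth`, stub `stub_instantiate`; planner ym-idea-4 g18)

The slab action reads only the links of the closed slab (`dependsOn_slabAction`), the complementary action only the complementary ones; the
GLUING of two boundary slices into a product-Haar configuration is a composite of two coordinate splices, so `∫ F dπ = ∫dX ∫dA ∫dU F(glue U X A)`
(`integral_glue`, from `LatticeRP.measurePreserving_splice`) and disjoint link blocks are independent (`integral_mul_of_dependsOn`).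
HONEST FRAMING: lattice bookkeeping toward ONE crux of a draft route (fixed torus, finite lattice); nothing here proves the route's target
`MarginalTwistOnset.FixedTorusCriterionFailure`, any continuum statement, or the Yang–Mills mass gap.  THEOREMS ONLY (no `def`, no `sorry`),
standard axioms.  References: [cite: OsterwalderSeiler1978, §2]; [cite: tHooft1979]; E. T. Tomboulis, L. G. Yaffe, CMP 100 (1985) 313;
[cite: Luscher1983, §2].
-/

set_option autoImplicit false

noncomputable section

open scoped BigOperators
open MeasureTheory Literature.MathematicalPhysics.QuantumFieldTheory

namespace Summit.QuantumFields.YangMills.Theorems.CentreWallReflection.Slab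

open MeasureTheory
open Literature.MathematicalPhysics.QuantumFieldTheory.LatticeRP (splice measurePreserving_splice measurable_splice)

variable {n : ℕ} {G : Type*} [Group G] {N : ℕ} (ρ : G →* Matrix (Fin N) (Fin N) ℂ) (μ : Fin 4)

/-! ## §5 Edge sets and `DependsOn` -/

omit [Group G] in
/-- `mem_sliceEdges` (slab bookkeeping, see the module docstring). -/
@[simp] theorem mem_sliceEdges (t : ZMod (n + 1)) (e : Edge 4 (n + 1)) : e ∈ sliceEdges μ t ↔ e.2 ≠ μ ∧ e.1 μ = t := by
  simp [sliceEdges]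

/-- `mem_slabEdges` (slab bookkeeping, see the module docstring). -/
@[simp] theorem mem_slabEdges (j : ℕ) (e : Edge 4 (n + 1)) :
    e ∈ slabEdges μ j ↔ (if e.2 = μ then (e.1 μ).val < j else (e.1 μ).val ≤ j) := by simp [slabEdges]

/-- `mem_slabInterior` (slab bookkeeping, see the module docstring). -/
@[simp] theorem mem_slabInterior (j : ℕ) (e : Edge 4 (n + 1)) :
    e ∈ slabInterior μ j ↔ (if e.2 = μ then (e.1 μ).val < j else (0 < (e.1 μ).val ∧ (e.1 μ).val < j)) := by simp [slabInterior]

/-- `mem_coSlabEdges` (slab bookkeeping, see the module docstring). -/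
@[simp] theorem mem_coSlabEdges (j : ℕ) (e : Edge 4 (n + 1)) :
    e ∈ coSlabEdges μ j ↔ (if e.2 = μ then j ≤ (e.1 μ).val else (j ≤ (e.1 μ).val ∨ (e.1 μ).val = 0)) := by simp [coSlabEdges]

/-- `disjoint_slabInterior_coSlabEdges` (slab bookkeeping, see the module docstring). -/
theorem disjoint_slabInterior_coSlabEdges (j : ℕ) : Disjoint (slabInterior (n := n) μ j) (coSlabEdges μ j) := by
  rw [Finset.disjoint_left]
  intro e h1 h2
  rw [mem_slabInterior] at h1; rw [mem_coSlabEdges] at h2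
  split_ifs at h1 h2 <;> omega

/-- `slabAction_add_coSlabAction` (slab bookkeeping, see the module docstring). -/
theorem slabAction_add_coSlabAction (j : ℕ) (W : GaugeConfig 4 (n + 1) G) :
    slabAction ρ μ j W + coSlabAction ρ μ j W = ∑ p : Plaquette 4 (n + 1), plaqCost ρ W p := by
  unfold slabAction coSlabAction
  rw [← Finset.sum_add_distrib]
  exact Finset.sum_congr rfl fun p _ => by ring

/-- `coSlabAction_eq_slabAction_translate` (slab bookkeeping, see the module docstring). -/
theorem coSlabAction_eq_slabAction_translate {j : ℕ} (hj1 : 1 ≤ j) (hjn : j ≤ n) (W : GaugeConfig 4 (n + 1) G) :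
    coSlabAction ρ μ j W = slabAction ρ μ (n + 1 - j) (translate μ (j : ZMod (n + 1)) W) := by
  have h := sum_plaqCost_eq_slab_add ρ μ hj1 hjn W
  rw [← slabAction_add_coSlabAction ρ μ j W] at h
  linarith

/-- The values of a plaquette holonomy agree for configurations agreeing on its four links. -/
theorem plaquetteHolonomy_congr {U V : GaugeConfig 4 (n + 1) G} {x : Site 4 (n + 1)} {a b : Fin 4}
    (h1 : U (x, a) = V (x, a)) (h2 : U (x.shift a, b) = V (x.shift a, b)) (h3 : U (x.shift b, a) = V (x.shift b, a))
    (h4 : U (x, b) = V (x, b)) : plaquetteHolonomy U x a b = plaquetteHolonomy V x a b := by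
  simp only [plaquetteHolonomy, h1, h2, h3, h4]

omit [Group G] in
/-- `shift_apply_self'` (slab bookkeeping, see the module docstring). -/
theorem shift_apply_self' (x : Site 4 (n + 1)) (k : Fin 4) : (x.shift k) k = x k + 1 := by
  simp [Site.shift]

omit [Group G] in
/-- `shift_apply_of_ne'` (slab bookkeeping, see the module docstring). -/
theorem shift_apply_of_ne' (x : Site 4 (n + 1)) {i k : Fin 4} (h : k ≠ i) : (x.shift i) k = x k := by
  simp [Site.shift, Pi.single_eq_of_ne h]

omit [Group G] in
/-- `val_add_one_of_lt` (slab bookkeeping, see the module docstring). -/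
theorem val_add_one_of_lt {t : ZMod (n + 1)} {j : ℕ} (h : t.val < j) (hjn : j ≤ n) : (t + 1).val = t.val + 1 := by
  rw [ZMod.val_add, ZMod.val_one_eq_one_mod, Nat.add_mod_mod, Nat.mod_eq_of_lt (by omega)]

/-- The slab action reads only the links of the closed slab. -/
theorem dependsOn_slabAction {j : ℕ} (hjn : j ≤ n) :
    DependsOn (fun W : GaugeConfig 4 (n + 1) G => slabAction ρ μ j W) ((slabEdges μ j : Finset (Edge 4 (n + 1))) : Set (Edge 4 (n + 1))) := by
  intro U V hUV
  unfold slabAction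
  refine Finset.sum_congr rfl fun p _ => ?_
  by_cases hw : slabWeight μ j p = 0
  · rw [hw, zero_mul, zero_mul]
  congr 1
  obtain ⟨x, ⟨⟨a, b⟩, hab⟩⟩ := p
  have key : ∀ (y : Site 4 (n + 1)) (c : Fin 4), (if c = μ then (y μ).val < j else (y μ).val ≤ j) → U (y, c) = V (y, c) :=
    fun y c he => hUV (y, c) (by rw [Finset.mem_coe, mem_slabEdges]; exact he)
  have hne : (a : Fin 4) ≠ b := ne_of_lt hab
  unfold slabWeight at hw
  dsimp only at hw
  refine congrArg (fun g : G => (N : ℝ) - (ρ g).trace.re) ?_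
  show plaquetteHolonomy U x a b = plaquetteHolonomy V x a b
  by_cases hT : isTemporal μ (x, ⟨(a, b), hab⟩) = true
  · rw [if_pos hT] at hw
    have hlt : (x μ).val < j := by by_contra h; exact hw (if_neg h)
    have hx1 : (x μ + 1).val = (x μ).val + 1 := val_add_one_of_lt hlt hjn
    rcases (isTemporal_iff μ _).mp hT with haμ | hbμ
    · dsimp only at haμ; subst haμ
      refine plaquetteHolonomy_congr (key _ _ ?_) (key _ _ ?_) (key _ _ ?_) (key _ _ ?_)
      · rw [if_pos rfl]; exact hlt
      · rw [if_neg (Ne.symm hne), shift_apply_self', hx1]; omega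
      · rw [if_pos rfl, shift_apply_of_ne' x hne]; exact hlt
      · rw [if_neg (Ne.symm hne)]; omega
    · dsimp only at hbμ; subst hbμ
      refine plaquetteHolonomy_congr (key _ _ ?_) (key _ _ ?_) (key _ _ ?_) (key _ _ ?_)
      · rw [if_neg hne]; omega
      · rw [if_pos rfl, shift_apply_of_ne' x (Ne.symm hne)]; exact hlt
      · rw [if_neg hne, shift_apply_self', hx1]; omega
      · rw [if_pos rfl]; exact hlt
  · rw [if_neg hT] at hw
    have haμ : a ≠ μ := fun h => hT ((isTemporal_iff μ _).mpr (Or.inl h))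
    have hbμ : b ≠ μ := fun h => hT ((isTemporal_iff μ _).mpr (Or.inr h))
    have hle : (x μ).val ≤ j := by
      by_contra h
      apply hw
      rw [if_neg (by omega), if_neg (by omega)]
    refine plaquetteHolonomy_congr (key _ _ ?_) (key _ _ ?_) (key _ _ ?_) (key _ _ ?_)
    · rw [if_neg haμ]; exact hle
    · rw [if_neg hbμ, shift_apply_of_ne' x (Ne.symm haμ)]; exact hle
    · rw [if_neg haμ, shift_apply_of_ne' x (Ne.symm hbμ)]; exact hle
    · rw [if_neg hbμ]; exact hle

/-- The complementary slab action reads only the links of the closed complementary slab. -/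
theorem dependsOn_coSlabAction (j : ℕ) :
    DependsOn (fun W : GaugeConfig 4 (n + 1) G => coSlabAction ρ μ j W)
      ((coSlabEdges μ j : Finset (Edge 4 (n + 1))) : Set (Edge 4 (n + 1))) := by
  intro U V hUV
  unfold coSlabAction
  refine Finset.sum_congr rfl fun p _ => ?_
  by_cases hw : 1 - slabWeight μ j p = 0
  · rw [hw, zero_mul, zero_mul]
  congr 1
  obtain ⟨x, ⟨⟨a, b⟩, hab⟩⟩ := p
  have key : ∀ (y : Site 4 (n + 1)) (c : Fin 4), (if c = μ then j ≤ (y μ).val else (j ≤ (y μ).val ∨ (y μ).val = 0)) →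
      U (y, c) = V (y, c) :=
    fun y c he => hUV (y, c) (by rw [Finset.mem_coe, mem_coSlabEdges]; exact he)
  have hne : (a : Fin 4) ≠ b := ne_of_lt hab
  have hxn : (x μ).val < n + 1 := ZMod.val_lt _
  -- `(x μ + 1).val` is `(x μ).val + 1` or `0`
  have hx1 : j ≤ (x μ).val → (j ≤ (x μ + 1).val ∨ (x μ + 1).val = 0) := by
    intro hj
    rw [ZMod.val_add, ZMod.val_one_eq_one_mod, Nat.add_mod_mod]
    by_cases h : (x μ).val + 1 < n + 1
    · left; rw [Nat.mod_eq_of_lt h]; omega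
    · right; have : (x μ).val + 1 = n + 1 := by omega
      rw [this, Nat.mod_self]
  unfold slabWeight at hw
  dsimp only at hw
  refine congrArg (fun g : G => (N : ℝ) - (ρ g).trace.re) ?_
  show plaquetteHolonomy U x a b = plaquetteHolonomy V x a b
  by_cases hT : isTemporal μ (x, ⟨(a, b), hab⟩) = true
  · rw [if_pos hT] at hw
    have hle : j ≤ (x μ).val := by by_contra h; push Not at h; exact hw (by rw [if_pos h]; norm_num)
    rcases (isTemporal_iff μ _).mp hT with haμ | hbμ
    · dsimp only at haμ; subst haμ
      refine plaquetteHolonomy_congr (key _ _ ?_) (key _ _ ?_) (key _ _ ?_) (key _ _ ?_)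
      · rw [if_pos rfl]; exact hle
      · rw [if_neg (Ne.symm hne), shift_apply_self']; exact hx1 hle
      · rw [if_pos rfl, shift_apply_of_ne' x hne]; exact hle
      · rw [if_neg (Ne.symm hne)]; exact Or.inl hle
    · dsimp only at hbμ; subst hbμ
      refine plaquetteHolonomy_congr (key _ _ ?_) (key _ _ ?_) (key _ _ ?_) (key _ _ ?_)
      · rw [if_neg hne]; exact Or.inl hle
      · rw [if_pos rfl, shift_apply_of_ne' x (Ne.symm hne)]; exact hle
      · rw [if_neg hne, shift_apply_self']; exact hx1 hle
      · rw [if_pos rfl]; exact hle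
  · rw [if_neg hT] at hw
    have haμ : a ≠ μ := fun h => hT ((isTemporal_iff μ _).mpr (Or.inl h))
    have hbμ : b ≠ μ := fun h => hT ((isTemporal_iff μ _).mpr (Or.inr h))
    have hle : j ≤ (x μ).val ∨ (x μ).val = 0 := by
      by_contra h; push Not at h
      apply hw
      rw [if_pos (by omega)]; norm_num
    refine plaquetteHolonomy_congr (key _ _ ?_) (key _ _ ?_) (key _ _ ?_) (key _ _ ?_)
    · rw [if_neg haμ]; exact hle
    · rw [if_neg hbμ, shift_apply_of_ne' x (Ne.symm haμ)]; exact hle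
    · rw [if_neg haμ, shift_apply_of_ne' x (Ne.symm hbμ)]; exact hle
    · rw [if_neg hbμ]; exact hle

/-! ## §6 Gluing and its interaction with translation and twist -/

omit [Group G] in
/-- After gluing, a function of the closed slab depends on `U` only through the slab interior. -/
theorem dependsOn_glue_of_dependsOn {β : Type*} {f : GaugeConfig 4 (n + 1) G → β} {S : Finset (Edge 4 (n + 1))}
    (hf : DependsOn f (S : Set (Edge 4 (n + 1)))) (j : ℕ) (X A : GaugeConfig 4 (n + 1) G) :
    DependsOn (fun U => f (glue μ j U X A))
      ((S.filter fun e => ¬ (e.2 ≠ μ ∧ (e.1 μ = 0 ∨ e.1 μ = (j : ZMod (n + 1)))) : Finset (Edge 4 (n + 1))) : Set _) := by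
  intro U V hUV
  apply hf
  intro e he
  by_cases hb : e.2 ≠ μ ∧ (e.1 μ = 0 ∨ e.1 μ = (j : ZMod (n + 1)))
  · rcases hb.2 with h0 | hj
    · rw [glue_apply_slice0 μ j U X A hb.1 h0, glue_apply_slice0 μ j V X A hb.1 h0]
    · unfold glue; simp only [hb.1, hj, ne_eq, not_false_eq_true, true_and, if_true]
  · have hU : glue μ j U X A e = U e := by
      unfold glue
      by_cases h2 : e.2 = μ
      · simp [h2]
      · have : ¬ (e.1 μ = 0 ∨ e.1 μ = (j : ZMod (n + 1))) := fun h => hb ⟨h2, h⟩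
        push Not at this
        simp [this.1, this.2]
    have hV : glue μ j V X A e = V e := by
      unfold glue
      by_cases h2 : e.2 = μ
      · simp [h2]
      · have : ¬ (e.1 μ = 0 ∨ e.1 μ = (j : ZMod (n + 1))) := fun h => hb ⟨h2, h⟩
        push Not at this
        simp [this.1, this.2]
    rw [hU, hV]
    exact hUV e (by rw [Finset.coe_filter]; exact ⟨he, hb⟩)

/-- `slabEdges_filter_subset_interior` (slab bookkeeping, see the module docstring). -/
theorem slabEdges_filter_subset_interior (j : ℕ) :
    ((slabEdges μ j).filter fun e : Edge 4 (n + 1) => ¬ (e.2 ≠ μ ∧ (e.1 μ = 0 ∨ e.1 μ = (j : ZMod (n + 1))))) ⊆ slabInterior μ j := by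
  intro e he
  rw [Finset.mem_filter, mem_slabEdges] at he
  rw [mem_slabInterior]
  obtain ⟨h1, h2⟩ := he
  by_cases hμ : e.2 = μ
  · rw [if_pos hμ] at h1 ⊢; exact h1
  · rw [if_neg hμ] at h1 ⊢
    have h2' : ¬ (e.1 μ = 0 ∨ e.1 μ = (j : ZMod (n + 1))) := fun h => h2 ⟨hμ, h⟩
    push Not at h2'
    have hv0 : (e.1 μ).val ≠ 0 := fun h => h2'.1 ((ZMod.val_eq_zero _).mp h)
    have hvj : (e.1 μ).val ≠ j := by
      intro h; apply h2'.2
      have := ZMod.natCast_zmod_val (e.1 μ)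
      rw [h] at this; exact this.symm
    omega

/-- `coSlabEdges_filter_subset` (slab bookkeeping, see the module docstring). -/
theorem coSlabEdges_filter_subset {j : ℕ} :
    ((coSlabEdges μ j).filter fun e : Edge 4 (n + 1) => ¬ (e.2 ≠ μ ∧ (e.1 μ = 0 ∨ e.1 μ = (j : ZMod (n + 1))))) ⊆ coSlabEdges μ j :=
  Finset.filter_subset _ _

omit [Group G] in
/-- Translating a glued configuration by `j`: the complementary slab becomes the slab `[0, n+1−j]` with the boundary data exchanged. -/
theorem translate_glue {j : ℕ} (hj1 : 1 ≤ j) (hjn : j ≤ n) (U X A : GaugeConfig 4 (n + 1) G) :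
    translate μ (j : ZMod (n + 1)) (glue μ j U X A) = glue μ (n + 1 - j) (translate μ (j : ZMod (n + 1)) U) A X := by
  have hj0 : ((j : ℕ) : ZMod (n + 1)) ≠ 0 := by
    rw [Ne, ZMod.natCast_eq_zero_iff]; intro h; have := Nat.le_of_dvd (by omega) h; omega
  have hcast : ((n + 1 - j : ℕ) : ZMod (n + 1)) = -(j : ZMod (n + 1)) := by
    rw [Nat.cast_sub (by omega), ZMod.natCast_self, zero_sub]
  funext e
  simp only [translate_apply]
  unfold glue
  simp only [Pi.add_apply, Pi.single_eq_same, hcast]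
  by_cases h2 : e.2 = μ
  · simp [h2]
  · simp only [h2, ne_eq, not_false_eq_true, true_and]
    by_cases h0 : e.1 μ = 0
    · have hA : e.1 μ + (j : ZMod (n + 1)) = (j : ZMod (n + 1)) := by rw [h0, zero_add]
      have hB : ¬ (e.1 μ + (j : ZMod (n + 1)) = 0) := by rw [hA]; exact hj0
      rw [if_neg hB, if_pos hA, if_pos h0]
      simp only [add_sub_cancel_right]
    · by_cases hm : e.1 μ = -(j : ZMod (n + 1))
      · have hA : e.1 μ + (j : ZMod (n + 1)) = 0 := by rw [hm, neg_add_cancel]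
        rw [if_pos hA, if_neg h0, if_pos hm, Pi.single_neg, sub_neg_eq_add]
      · have hA : ¬ (e.1 μ + (j : ZMod (n + 1)) = 0) := fun h => hm (eq_neg_of_add_eq_zero_left h)
        have hB : ¬ (e.1 μ + (j : ZMod (n + 1)) = (j : ZMod (n + 1))) := fun h => h0 (by simpa using h)
        rw [if_neg hA, if_neg hB, if_neg h0, if_neg hm]
        rfl

/-- The twist on slice `0` commutes with gluing (it acts on the `X`-data). -/
theorem twistMap_glue (ν : Fin 4) (hμν : μ ≠ ν) (z : G) (j : ℕ) (U X A : GaugeConfig 4 (n + 1) G) :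
    twistMap μ ν z (glue μ j U X A) = glue μ j U (twistMap μ ν z X) A := by
  funext e
  simp only [twistMap_apply]
  by_cases hs : e.2 = ν ∧ e.1 μ = 0 ∧ e.1 ν = 0
  · rw [if_pos hs]
    have h2 : e.2 ≠ μ := by rw [hs.1]; exact hμν.symm
    rw [glue_apply_slice0 μ j U X A h2 hs.2.1, glue_apply_slice0 μ j U _ A h2 hs.2.1, twistMap_apply, if_pos hs]
  · rw [if_neg hs, one_mul]
    unfold glue
    split_ifs with h0
    · rw [twistMap_apply, if_neg hs, one_mul]
    · rfl
    · rfl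

end Summit.QuantumFields.YangMills.Theorems.CentreWallReflection.Slab

end
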